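import Summits.CriticalPhenomena.SAWScalingLimit.Theses.SAWDefectDecoherence
import Summits.CriticalPhenomena.SAWScalingLimit.Theorems.MassRatio.Negative.Brick
import Summits.CriticalPhenomena.SAWScalingLimit.Theorems.MassRatio.Negative.Walks
import Summits.CriticalPhenomena.SAWScalingLimit.Theorems.MassRatio.Negative.Tools
import Summits.CriticalPhenomena.SAWScalingLimit.Theorems.MassRatio.Negative.Domain

/-!
# Crux `SAWDefectDecoherence.MassRatio` (stmt-CriticalPhenomena-8550) — line `mirror-doubling-endpoint-restriction`

Skeleton (crux-plan, round 2) for the crux idea card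
`Cruxes/MassRatio/Ideas/mirror-doubling-endpoint-restriction.md` (ideator 5; triage r2: 3 × pass,
with the mandatory sharpening S1 and the typing remarks (a)–(c) of TRIAGE-r2-1/2/3 built in below).

**Idea.** `MassRatio` compares two POSITIVE critical SAW masses from the root `a_δ` — the bulk mass
`δ² Σ_{e ∈ K} Z_δ(e)` and the boundary point mass `Z_δ(b_δ)` — at the cut `δ^{-3/4}` (predicted
ratio `δ^{-(h_b - x_1)} = δ^{-25/48}`, slack `11/48`; FALSE for simple random walk, whose value is
`δ^{-1}`). The rows clause makes `Λ_δ ∩ B(b,ρ)` an EXACT half-lattice, so a lattice ball hung under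
the door edge `b_δ` glues in: in the doubled domain `Λ⁺_δ := Λ_δ ∪ Ball(mid b_δ, R)`,
`R = ⌊ρ'/δ⌋`, the point `b_δ` is a deep BULK mid-edge, and with no walk ever cut
`Z_Λ(a→b_δ) = Z_{Λ⁺}(a→b_δ) · P_{Λ⁺}[γ avoids the phantom half-ball]`, `Z_Λ(a→e) ≤ Z_{Λ⁺}(a→e)`.
So the crux factorises EXACTLY (glue `massRatioAt_of`, kernel-checked) into
* an interior Harnack comparison inside `Λ⁺` at exponent `0` (`stub_interiorHarnack`), and
* ONE one-sided restriction lower bound at the endpoint, `P[avoid] ≥ c δ^{3/4}`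
  (`EndpointRestriction (3/4)`, predicted `δ^{25/48}`), which inherits the whole slack,
and the restriction bound is in turn read off the card's CANONICAL one-parameter lattice family
(Transfer (iii) of the card): the exact upper half-lattice half-disc `H_R` of radius `4R` with the
door edge `c₀` at its centre and the root door edge `a_R` at distance `2R` along the boundary row,
doubled by the lattice ball of radius `R` under `c₀` —
* `stub_canonicalRestriction` : `Z_{H_R}(a_R → c₀) ≥ c₀ R^{-3/4} Z_{H_R ∪ Ball_R}(a_R → c₀)` for all
  `R ≥ 1` (the sharp exponent content, predicted `R^{-25/48}`; HARDEST), and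
* `stub_ratioMixing` : the frame's avoidance ratio at scale `R = ⌊ρ'/δ⌋` is at least a constant
  times the canonical one (quasi-multiplicativity of the conditioned arrival law at `b`, exponent
  `0`; a statement about four partition functions, nothing cut).
`endpointRestriction_of_canonical` (proved) turns the last two into `EndpointRestriction t` for
every `t ≥ 0`, and `MassRatio_of` concludes the crux BY NAME at the filed cut `3/4`.

**Proved here (no `sorry`; axioms `propext`, `Classical.choice`, `Quot.sound`).** `Z_mono` (domain
monotonicity of the `σ = 0` mass: the injection `HexMidEdgeSAW Λ ↪ HexMidEdgeSAW Λ'`),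
`finite_ball` / `ball` (lattice balls are finite sets), `rho0_pos` (the radius cap
`ρ₀ = min(ρ, |pt 0 − pt 1|)/8` is positive: marked points are distinct, `MarkedDomain.pt_injective`),
`canonical_pos` (the canonical masses are positive: the boundary-row walk `a_R → c₀`, via the landed
`Negative.corridorWalk` / `pow_length_le_norm_Z`), `endpointRestriction_of_canonical`
(`CanonicalRestriction t → RatioMixing → EndpointRestriction t`, `t ≥ 0`: scale matching
`R = ⌊ρ'/δ⌋ ≤ ρ'/δ`, `R^{-t} ≥ ρ'^{-t} δ^{t}`), `massRatioAt_of`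
(`InteriorHarnack s → EndpointRestriction t → MassRatioAt (s + t)`, every cut: monotonicity,
Harnack with `max C 0`, restriction as an upper bound on `Z_{Λ⁺}(b_δ)`, `δ^{-s}/δ^{t} = δ^{-(s+t)}`),
`MassRatio_of : SAWDefectDecoherence.MassRatio` (the composition at `s = 0`, `t = 3/4`).

**Typing decisions (triage r2).** S1 (r2-1/2, mandatory): every radius is capped by
`ρ₀ := min(ρ, dist(pt 0, pt 1))/8`, so the root `a_δ → pt 0` stays at distance `≥ 8ρ'` from `b` and is
never swallowed by the doubling or by the embedded canonical half-disc (radius `4Rδ ≤ 4ρ'`), even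
when `pt 0` lies on the flat piece inside `B(pt 1, ρ)`; (c) (r2-1/3): ONE explicit doubling
`double Λ b R = Λ ∪ Ball(mid b, R)` (no `∀ Λp` quantifier; by `Z_mono` the restriction statement for
it implies the one for every smaller doubling); the phantom ball is centred at the ACTUAL midpoint of
`b_δ` (not at `pt 1`), so the canonical pair `(H_R ⊆ H_R ∪ Ball_R, a_R, c₀)` embeds into
`(Λ_δ ⊆ Λ⁺_δ, ·, b_δ)` by an exact lattice translation once `b_δ` is a door edge (eventually forced
by the rows clause + `b_δ → b`); (b) (r2-3): `InteriorHarnack` is recorded in the line card as a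
pointwise LOWER bound at a bulk point with no surgery proof at any `s`. The costume warning
(r2-2 S2 / r2-3 L5(iii): modulo Harnack(0), `EndpointRestriction (3/4) ⟺ MassRatio`) is answered
by moving the registered hard stub to the CANONICAL family, which has no frame, no `K`, no
admissible-family freedom and is directly measurable (card, Cheapest falsifier (2)).

**Disproof used** (`Cruxes/MassRatio/Disproof.lean` cycle 4 + companions; landed
`Theorems/MassRatio/Negative/*`, of which `Brick/Walks/Tools/Domain` are IMPORTED here):
`massRatio_false_without_rows` / `_rho_pos` (§G) — honoured and USED: the doubling and the embedded
canonical half-disc exist only on the exact half-lattice piece of positive radius (all three stubs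
carry the full `Frame`, rows clause included; on the fjord witness `Λ₂` there is no ball under the
tip `b'_δ` inside `Λ`-free lattice and `stub_ratioMixing`'s translation picture is void);
`massRatio_false_without_bLimit` (§H) — the phantom ball is centred at `mid b_δ` and the cap `ρ₀`
keeps it inside `B(pt 1, ρ/4)` only because `δ·mid b_δ → pt 1`; `massRatio_false_without_exhaustion`
(§K) — exhaustion sits in `Frame` and is consumed by `stub_interiorHarnack` on the `K`-side (on `Λ₃`
the `K`-edge sits on a bare corridor and Harnack fails exactly where exhaustion fails);
`corridor_transfer` / `verts_eq_corridor` (§C) — every stub is a ratio with the common root `a_δ`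
(or does not mention the frame at all), invariant under bare root corridors; §J `star_bounds` and the
DEAD list (W1 floor, W2 Conj.-2 modulus, VR-only RH fields, pinch at `b`, punctured sum rule) — not
touched: `σ = 0` throughout, no `F_{5/8}`, no vertex relation, no walk decomposition;
`massRatio_frame_nonvacuous` (§F) — the common hypothesis `Frame` is the crux's frame verbatim, hence
satisfiable. ROUND-2 BRIEF (ii) (one lattice step of endpoint surgery costs a polynomial factor):
the reason neither `stub_interiorHarnack` nor `stub_ratioMixing` has a surgery proof — both are
comparability statements over a macroscopic window, the brief's "missing primitive", here in
restriction form. No landed `Negative/` lemma refutes an instance of any stub (they refute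
hypothesis-dropped variants of the crux; every stub keeps all four load-bearing clauses).
-/

namespace Summit.CriticalPhenomena.SAWScalingLimit.Cruxes.MassRatio.MirrorDoublingEndpointRestriction

open Literature.Probability.LatticeModels Literature.Probability.RandomPlanarGeometry
open Literature.Probability.RandomPlanarGeometry.SAW
open Summit.CriticalPhenomena.SAWScalingLimit.Theses.SAWDefectDecoherence
open Summit.CriticalPhenomena.SAWScalingLimit.Theorems.MassRatio

noncomputable section

/-! ## Definitions (sorry-free; to be landed verbatim in a `Theorems/…Defs.lean` by the lead) -/

/-- The critical two-point mass `Z_Λ(a → z) = |F_{x_c,0}(z)| = Σ_{γ ⊂ Λ : a → z} x_c^{ℓ(γ)}`. -/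
def Z (Λ : Finset HexVertex) (a z : Sym2 HexVertex) : ℝ :=
  ‖hexParafermionicObservable Λ a hexCriticalFugacity 0 z‖

/-- The hypothesis frame of `SAWDefectDecoherence.MassRatio`, verbatim, packaged as one predicate
(`0 < ρ`, flat half-plane piece and rows clause at `b = D.pt 1`, admissible family, exhaustion,
`a_δ → pt 0`, `b_δ → pt 1`). -/
def Frame (D : DobrushinDomain) (ρ : ℝ) (Λ : ℝ → Finset HexVertex) (m : ℝ → ℤ)
    (a b : ℝ → Sym2 HexVertex) : Prop :=
  0 < ρ ∧
  D.carrier ∩ Metric.ball (D.pt 1) ρ = {z : ℂ | (D.pt 1).im < z.im} ∩ Metric.ball (D.pt 1) ρ ∧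
  (∀ᶠ δ : ℝ in nhdsWithin 0 (Set.Ioi 0),
    hexDomainSimplyConnected (Λ δ) ∧ a δ ∈ hexDomainBoundary (Λ δ) ∧
    b δ ∈ hexDomainBoundary (Λ δ) ∧ Nonempty (HexMidEdgeSAW (Λ δ) (a δ) (b δ)) ∧
    (hexGraph.induce ((Λ δ : Finset HexVertex) : Set HexVertex)).Preconnected ∧
    (∀ v ∈ Λ δ, (δ : ℂ) * hexCenter v ∈ D.carrier) ∧
    (∀ v : HexVertex, (δ : ℂ) * hexCenter v ∈ Metric.ball (D.pt 1) ρ →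
      (v ∈ Λ δ ↔ m δ ≤ v.1 1))) ∧
  (∀ K : Set ℂ, IsCompact K → K ⊆ D.carrier → ∀ᶠ δ : ℝ in nhdsWithin 0 (Set.Ioi 0),
    ∀ v : HexVertex, (δ : ℂ) * hexCenter v ∈ K → v ∈ Λ δ) ∧
  Filter.Tendsto (fun δ : ℝ => (δ : ℂ) * hexMidpoint (a δ)) (nhdsWithin 0 (Set.Ioi 0))
    (nhds (D.pt 0)) ∧
  Filter.Tendsto (fun δ : ℝ => (δ : ℂ) * hexMidpoint (b δ)) (nhdsWithin 0 (Set.Ioi 0))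
    (nhds (D.pt 1))

/-- For `δ > 0` only finitely many honeycomb vertices have their scaled centre in a given ball
(brick coordinates are bounded there). -/
theorem finite_scaled_ball (δ : ℝ) (hδ : 0 < δ) (z : ℂ) (R : ℝ) :
    {v : HexVertex | (δ : ℂ) * hexCenter v ∈ Metric.ball z R}.Finite := by
  classical
  set M : ℝ := ‖z‖ + |R| with hM
  have hM0 : 0 ≤ M := by positivity
  have hh := Negative.hgt_pos
  obtain ⟨N, hN⟩ : ∃ N : ℕ, 2 * M / δ + M / (δ * Negative.hgt) + 2 ≤ N := exists_nat_ge _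
  have hN1 : 2 * M / δ + 1 ≤ N := by
    have : 0 ≤ M / (δ * Negative.hgt) := by positivity
    linarith
  have hN2 : M / (δ * Negative.hgt) + 1 ≤ N := by
    have : 0 ≤ 2 * M / δ := by positivity
    linarith
  refine Set.Finite.subset (((Finset.Icc (-(N : ℤ)) N) ×ˢ (Finset.Icc (-(N : ℤ)) N)).image
    (fun rp : ℤ × ℤ => Negative.bv rp.1 rp.2)).finite_toSet ?_
  intro v hv
  simp only [Set.mem_setOf_eq, Metric.mem_ball] at hv
  have hnorm : ‖(δ : ℂ) * hexCenter v‖ < M := by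
    have h1 : ‖(δ : ℂ) * hexCenter v‖ ≤ ‖(δ : ℂ) * hexCenter v - z‖ + ‖z‖ := by
      have := norm_add_le ((δ : ℂ) * hexCenter v - z) z
      simpa using this
    have h2 : ‖(δ : ℂ) * hexCenter v - z‖ < R := by rwa [← dist_eq_norm]
    have h3 : R ≤ |R| := le_abs_self R
    linarith
  have hre : |((δ : ℂ) * hexCenter v).re| < M :=
    lt_of_le_of_lt (Complex.abs_re_le_norm _) hnorm
  have him : |((δ : ℂ) * hexCenter v).im| < M :=
    lt_of_le_of_lt (Complex.abs_im_le_norm _) hnorm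
  rw [Negative.re_scaled] at hre
  have him1 := Negative.im_scaled_ge δ hδ.le v
  have him2 := Negative.im_scaled_le δ hδ.le v
  rw [abs_lt] at hre him
  -- bounds on pos v
  have hp1 : ((Negative.pos v : ℝ)) ≤ N := by
    have : δ * ((Negative.pos v : ℝ) + 1) < 2 * M := by linarith [hre.2]
    have : (Negative.pos v : ℝ) + 1 < 2 * M / δ := by
      rw [lt_div_iff₀ hδ]; linarith
    linarith
  have hp2 : (-(N : ℝ)) ≤ (Negative.pos v : ℝ) := by
    have : -(2 * M) < δ * ((Negative.pos v : ℝ) + 1) := by linarith [hre.1]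
    have : -(2 * M / δ) < (Negative.pos v : ℝ) + 1 := by
      rw [neg_lt, lt_div_iff₀ hδ]; linarith
    linarith
  -- bounds on row v
  have hδh : 0 < δ * Negative.hgt := mul_pos hδ hh
  have hr1 : ((Negative.row v : ℝ)) ≤ N := by
    have : δ * Negative.hgt * ((Negative.row v : ℝ) + 1 / 3) < M := by linarith [him.2]
    have : (Negative.row v : ℝ) + 1 / 3 < M / (δ * Negative.hgt) := by
      rw [lt_div_iff₀ hδh]; linarith
    linarith
  have hr2 : (-(N : ℝ)) ≤ (Negative.row v : ℝ) := by
    have : -M < δ * Negative.hgt * ((Negative.row v : ℝ) + 2 / 3) := by linarith [him.1]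
    have : -(M / (δ * Negative.hgt)) < (Negative.row v : ℝ) + 2 / 3 := by
      rw [neg_lt, lt_div_iff₀ hδh]; linarith
    linarith
  simp only [Finset.coe_image, Finset.coe_product, Finset.coe_Icc, Set.mem_image, Set.mem_prod,
    Set.mem_Icc, Prod.exists]
  refine ⟨Negative.row v, Negative.pos v, ⟨⟨?_, ?_⟩, ?_, ?_⟩, Negative.bv_row_pos v⟩
  · exact_mod_cast hr2
  · exact_mod_cast hr1
  · exact_mod_cast hp2
  · exact_mod_cast hp1

/-- A lattice ball (vertices whose centre lies in `B(z, r)`) is a finite set. -/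
theorem finite_ball (z : ℂ) (r : ℝ) : {v : HexVertex | hexCenter v ∈ Metric.ball z r}.Finite := by
  simpa using finite_scaled_ball 1 one_pos z r

/-- The lattice ball `{v : c_v ∈ B(z, r)}` as a `Finset` (unscaled lattice coordinates). -/
def ball (z : ℂ) (r : ℝ) : Finset HexVertex := (finite_ball z r).toFinset

@[simp] theorem mem_ball {z : ℂ} {r : ℝ} {v : HexVertex} :
    v ∈ ball z r ↔ dist (hexCenter v) z < r := by
  simp [ball, Set.Finite.mem_toFinset]

/-- THE DOUBLING (one explicit choice, triage r2 (c)): `Λ` together with the lattice ball of radius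
`R` (lattice units) about the midpoint of the mid-edge `b`. In the frame, with `R = ⌊ρ'/δ⌋` and
`ρ' ≤ ρ₀`, the ball's upper half is already in `Λ_δ` (rows clause) and the added vertices are exactly
the mirror/phantom lower half-ball hanging from the door line under `b_δ` (the card's `Λ⁺_δ`;
`b_δ` becomes a bulk mid-edge at depth `≍ ρ'`). -/
def double (Λ : Finset HexVertex) (b : Sym2 HexVertex) (R : ℝ) : Finset HexVertex :=
  Λ ∪ ball (hexMidpoint b) R

theorem subset_double (Λ : Finset HexVertex) (b : Sym2 HexVertex) (R : ℝ) : Λ ⊆ double Λ b R :=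
  Finset.subset_union_left

/-- The lattice radius of the phantom ball at mesh `δ`: `R = ⌊ρ'/δ⌋`. -/
def scaleR (ρ' δ : ℝ) : ℕ := ⌊ρ' / δ⌋₊

/-- The radius cap of the line (triage r2 S1): `ρ₀ = min(ρ, dist(pt 0, pt 1)) / 8`. Every
construction at `b` lives in `B(b, 4ρ')`, `ρ' ≤ ρ₀`, hence inside the flat piece AND at distance
`≥ dist(pt 0, pt 1)/2` from the root. -/
def rho0 (D : DobrushinDomain) (ρ : ℝ) : ℝ := min ρ (dist (D.pt 0) (D.pt 1)) / 8

theorem rho0_pos (D : DobrushinDomain) {ρ : ℝ} (hρ : 0 < ρ) : 0 < rho0 D ρ := by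
  have h01 : D.pt 0 ≠ D.pt 1 := fun h => absurd (D.pt_injective h) (by decide)
  have hd : 0 < dist (D.pt 0) (D.pt 1) := dist_pos.2 h01
  unfold rho0
  exact div_pos (lt_min hρ hd) (by norm_num)

theorem rho0_le (D : DobrushinDomain) (ρ : ℝ) : 8 * rho0 D ρ ≤ ρ := by
  unfold rho0; linarith [min_le_left ρ (dist (D.pt 0) (D.pt 1))]

theorem rho0_le_dist (D : DobrushinDomain) (ρ : ℝ) : 8 * rho0 D ρ ≤ dist (D.pt 0) (D.pt 1) := by
  unfold rho0; linarith [min_le_right ρ (dist (D.pt 0) (D.pt 1))]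

/-! ### The canonical one-parameter family (card, Transfer (iii)) -/

/-- The canonical door edge `c₀ = {(row 0, pos 0), (row −1, pos 0)}` (midpoint `1/2 + 0·i`). -/
def cEdge : Sym2 HexVertex := s(Negative.bv 0 0, Negative.bv (-1) 0)

/-- The canonical root: the door edge of row `0` at position `4R`, i.e. at distance `2R` from `c₀`
along the boundary row (outer vertex first). -/
def aEdge (R : ℕ) : Sym2 HexVertex := s(Negative.bv (-1) (4 * R), Negative.bv 0 (4 * R))

/-- The canonical domain `H_R`: the exact upper half-lattice (`row ≥ 0`) inside the lattice disc of
radius `4R` about `mid c₀` — a half-disc with flat bottom, `c₀` and `a_R` door edges of it. Its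
doubling `double (halfDisc R) cEdge R = H_R ∪ Ball(mid c₀, R)` hangs the lattice ball of radius `R`
under `c₀`, which becomes a bulk mid-edge at depth `R`. -/
def halfDisc (R : ℕ) : Finset HexVertex :=
  (ball (hexMidpoint cEdge) (4 * R)).filter (fun v => 0 ≤ Negative.row v)

/-! ## The statements of the line -/

/-- INTERIOR HARNACK at exponent `s` (infimum form): in the doubled domain the (now bulk) mid-edge
`b_δ` is no cold spot of the rooted two-point function — the averaged bulk mass over a compact
`K ⊂ Ω` is at most `C δ^{-s}` times the mass at `b_δ`. Predicted exponent `0`. Same root, same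
domain, different bulk endpoints; no walk decomposed. A pointwise LOWER bound at a bulk point:
continuation surgery from `e ∈ K` to `b_δ` costs `x_c^{Θ(1/δ)}`, so there is no surgery proof at any
`s` (triage r2-3 (b); Disproof ROUND-2 BRIEF (ii)). -/
def InteriorHarnack (s : ℝ) : Prop :=
  ∀ (D : DobrushinDomain) (ρ : ℝ) (Λ : ℝ → Finset HexVertex) (m : ℝ → ℤ)
    (a b : ℝ → Sym2 HexVertex), Frame D ρ Λ m a b →
    ∀ ρ' : ℝ, 0 < ρ' → ρ' ≤ rho0 D ρ →
      ∀ K : Set ℂ, IsCompact K → K ⊆ D.carrier → ∃ C : ℝ, ∀ᶠ δ : ℝ in nhdsWithin 0 (Set.Ioi 0),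
        δ ^ 2 * (∑ᶠ e ∈ {e : Sym2 HexVertex | e ∈ hexDomainMidEdges (Λ δ) ∧
            (δ : ℂ) * hexMidpoint e ∈ K}, Z (double (Λ δ) (b δ) (scaleR ρ' δ)) (a δ) e)
          ≤ C * δ ^ (-s) * Z (double (Λ δ) (b δ) (scaleR ρ' δ)) (a δ) (b δ)

/-- ONE-SIDED RESTRICTION AT THE ENDPOINT (exponent `t`): the walks from the far root `a_δ` to the
deep bulk mid-edge `b_δ` of the doubled domain that avoid the phantom half-ball — i.e. stay in
`Λ_δ` — carry at least a `c δ^t` fraction of the mass. Predicted `t = h_b − x_1 = 25/48`; the line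
needs `t = 3/4`. DERIVED below from the canonical family (`endpointRestriction_of_canonical`). -/
def EndpointRestriction (t : ℝ) : Prop :=
  ∀ (D : DobrushinDomain) (ρ : ℝ) (Λ : ℝ → Finset HexVertex) (m : ℝ → ℤ)
    (a b : ℝ → Sym2 HexVertex), Frame D ρ Λ m a b →
    ∀ ρ' : ℝ, 0 < ρ' → ρ' ≤ rho0 D ρ →
      ∃ c : ℝ, 0 < c ∧ ∀ᶠ δ : ℝ in nhdsWithin 0 (Set.Ioi 0),
        c * δ ^ t * Z (double (Λ δ) (b δ) (scaleR ρ' δ)) (a δ) (b δ) ≤ Z (Λ δ) (a δ) (b δ)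

/-- CANONICAL RESTRICTION (exponent `t`): in the explicit family `H_R = halfDisc R`, the
boundary-to-boundary mass `Z_{H_R}(a_R → c₀)` is at least `c₀ R^{-t}` times the boundary-to-bulk
mass `Z_{H_R ∪ Ball_R}(a_R → c₀)` of the doubled half-disc, for every `R ≥ 1`. Predicted
`R^{-(h_b − x_1)} = R^{-25/48}` (both sides `≍` a common arrival factor times `R^{-2 h_b}` resp.
`R^{-(h_b + x_1)}`); the line needs `t = 3/4`; the simple-random-walk value is `R^{-1}` (fails). -/
def CanonicalRestriction (t : ℝ) : Prop :=
  ∃ c₀ : ℝ, 0 < c₀ ∧ ∀ R : ℕ, 1 ≤ R →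
    c₀ * (R : ℝ) ^ (-t) * Z (double (halfDisc R) cEdge R) (aEdge R) cEdge
      ≤ Z (halfDisc R) (aEdge R) cEdge

/-- RATIO MIXING (exponent `0`): in the frame, at scale `R = ⌊ρ'/δ⌋`, the avoidance ratio
`Z_Λ(a→b_δ)/Z_{Λ⁺}(a→b_δ)` is at least a constant times the canonical avoidance ratio
`Z_{H_R}(a_R→c₀)/Z_{H_R ∪ Ball_R}(a_R→c₀)` — written multiplied out (four partition functions,
nothing decomposed). The canonical pair embeds into `(Λ_δ ⊆ Λ⁺_δ)` by the lattice translation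
`c₀ ↦ b_δ` (exact: rows clause, `4Rδ ≤ 4ρ' ≤ ρ/2`); the content is that the law of the last `≍ ρ'`
of the walk near `b`, conditioned on arriving from distance `≥ ρ`, is comparable to the canonical
one (quasi-multiplicativity / separation for SAW arrivals; no tool today). Per-octave versions are
NOT what is asked: one constant for the whole event. -/
def RatioMixing : Prop :=
  ∀ (D : DobrushinDomain) (ρ : ℝ) (Λ : ℝ → Finset HexVertex) (m : ℝ → ℤ)
    (a b : ℝ → Sym2 HexVertex), Frame D ρ Λ m a b →
    ∀ ρ' : ℝ, 0 < ρ' → ρ' ≤ rho0 D ρ →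
      ∃ c : ℝ, 0 < c ∧ ∀ᶠ δ : ℝ in nhdsWithin 0 (Set.Ioi 0),
        c * (Z (double (Λ δ) (b δ) (scaleR ρ' δ)) (a δ) (b δ) *
              Z (halfDisc (scaleR ρ' δ)) (aEdge (scaleR ρ' δ)) cEdge)
          ≤ Z (Λ δ) (a δ) (b δ) *
              Z (double (halfDisc (scaleR ρ' δ)) cEdge (scaleR ρ' δ)) (aEdge (scaleR ρ' δ)) cEdge

/-- The crux at a general exponent cut `c` (`MassRatio` is `MassRatioAt (3/4)` up to `-(3/4) = -3/4`,
see `MassRatio_of`). -/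
def MassRatioAt (c : ℝ) : Prop :=
  ∀ (D : DobrushinDomain) (ρ : ℝ) (Λ : ℝ → Finset HexVertex) (m : ℝ → ℤ)
    (a b : ℝ → Sym2 HexVertex), Frame D ρ Λ m a b →
    ∀ K : Set ℂ, IsCompact K → K ⊆ D.carrier → ∃ C : ℝ, ∀ᶠ δ : ℝ in nhdsWithin 0 (Set.Ioi 0),
      δ ^ 2 * (∑ᶠ e ∈ {e : Sym2 HexVertex | e ∈ hexDomainMidEdges (Λ δ) ∧
          (δ : ℂ) * hexMidpoint e ∈ K}, Z (Λ δ) (a δ) e)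
        ≤ C * δ ^ (-c) * Z (Λ δ) (a δ) (b δ)

/-! ## Stubs (registered; `sorry` only here) -/

/-- **Stub 1 (hardest) — canonical restriction at the filed cut.** `∃ c₀ > 0, ∀ R ≥ 1,
c₀ R^{-3/4} Z_{H_R ∪ Ball_R}(a_R → c₀) ≤ Z_{H_R}(a_R → c₀)` in the explicit half-disc family
`halfDisc R` (radius `4R`, root door edge at distance `2R`, phantom ball of radius `R` under the
target door edge). Why plausibly true: predicted ratio `R^{-25/48}` with `11/48` to spare
(`h_b = 5/8`, `x_1 = 5/48`, LSW math/0204277 §3.4.2; continuum shadow: LSW Thm 2 restriction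
exponents `5/8` at the root, `5/48` at a bulk point). Why it might fail / status: OPEN — it must
certify a per-octave avoidance factor `≥ 2^{-3/4} = 0.59` against the fair-coin/SRW value `1/2`
(= cut `1`); no RSW/FKG for SAW (n = 0), folding of sub-diameter excursions is not injective
(barrier `SAWNotKineticallyGrown`); rigorous inputs in hand are exit-SUMMED (`escape_ge`,
`strip_escape_ge`, `B_T ≤ 1`). Falsifier: transfer matrix / MC on this very family (`R ≤ 10` exact,
`R ≤ 64` MC): local slope of `log(Z_H/Z_{H⁺})` vs `log R` must stay `> -3/4` (pred. `-0.52`).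
Size: XL / open. Leans on: `hexParafermionicObservable`, `Negative.bv` (brick coordinates),
`HexSAWEscapeMass.escape_ge`, `DuminilCopinSmirnov2012_lemma2_holds`, `YangBaxter.halfPlaneTwoPoint`
(technology-class references only). -/
theorem stub_canonicalRestriction : CanonicalRestriction (3 / 4) := by
  sorry

/-- **Stub 2 — ratio mixing (frame avoidance ratio ≥ c · canonical avoidance ratio at
`R = ⌊ρ'/δ⌋`, exponent 0).** Why plausibly true: both ratios are predicted `≍ (δ/ρ')^{25/48}` times
geometry-dependent constants; the phantom pocket is attached to `Λ_δ` only along the door line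
(rows clause), the canonical half-disc of radius `4Rδ ≤ ρ/2` translates exactly into
`Λ_δ ∩ B(b,ρ)`, and the root stays at distance `≥ 8ρ'` — so only the arrival law at scale `ρ'`
around `b` is compared (a boundary quasi-multiplicativity statement; for harmonic-measure driven
models a theorem via RSW/separation, here a bet). Why it might fail / status: OPEN, no SAW tool
(no domain Markov decomposition without a pinch: door/first-entry cuts cost `13/48`, rim pinches
`12/48`, card NOTE §1); a `δ`-dependent drift of the frame/canonical ratio by any power kills it.
Uses the rows clause, `b_δ → b` and `0 < ρ` (Disproof §G/§H: load-bearing) through `rho0` and the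
translation picture. Size: L–XL / open. Leans on: `Z_mono` (free one-sided sandwiches
`Z_{Λ∩Λ'} ≤ Z_Λ ≤ Z_{Λ∪Λ'}`), `Negative.verts_eq_corridor` (root corridors are common factors),
`massRatio_frame_nonvacuous` (frame satisfiable). -/
theorem stub_ratioMixing : RatioMixing := by
  sorry

/-- **Stub 3 — interior Harnack in the doubled domain at exponent exactly `0`.**
`δ² Σ_{e ∈ K} Z_{Λ⁺}(a→e) ≤ C · Z_{Λ⁺}(a→b_δ)` eventually, `Λ⁺ = double (Λ δ) (b δ) ⌊ρ'/δ⌋`.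
Why plausibly true: `b_δ` is the centre of a full lattice ball of radius `⌊ρ'/δ⌋` inside `Λ⁺`, fed
through the exhausted half-disc above it; both sides are predicted `≍ δ^{h_b + x_1}` times a
positive continuous boundary-to-bulk profile (LSW §3.4.2), so the ratio is `O(1)` — the most robust
statement of the line (lead-0 MC smoke data: Harnack slope `+0.12 ± noise` at `L ≤ 16`). Why it
might fail / status: OPEN at every `s` — a pointwise lower bound at ONE bulk point; stepwise
surgery costs a polynomial factor per lattice step (`Σ N p_N μ^{-N} < ∞` unknown in 2D, Disproof
ROUND-2 BRIEF (ii)), so it needs a window-to-point comparability in the bulk (same family as the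
boundary fair-share primitive, but at an interior point, where reflection positivity / symmetry of
the full ball is available). Exhaustion is load-bearing here (`massRatio_false_without_exhaustion`:
on `Λ₃` it fails exactly where exhaustion fails). Size: XL / open. Leans on: exhaustion clause of
`Frame`, `Z_mono`, `Negative.hexDomainMidEdges_finite`; sibling card `tip-rate-mean-value`
(super-mean-value property of `Z(a→·)`, exponent-0 glue) as a possible engine. -/
theorem stub_interiorHarnack : InteriorHarnack 0 := by
  sorry

/-! ## Proved: monotonicity, positivity of the canonical masses, the two compositions -/

theorem Z_nonneg (Λ : Finset HexVertex) (a z : Sym2 HexVertex) : 0 ≤ Z Λ a z := norm_nonneg _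

/-- Monotonicity of the critical two-point mass in the domain (walks of `Λ` are walks of
`Λ' ⊇ Λ`, weights `x_c^ℓ ≥ 0`). -/
theorem Z_mono {Λ Λ' : Finset HexVertex} (h : Λ ⊆ Λ') (a z : Sym2 HexVertex) :
    Z Λ a z ≤ Z Λ' a z := by
  classical
  have hx : (0 : ℝ) ≤ hexCriticalFugacity := by unfold hexCriticalFugacity; positivity
  unfold Z
  rw [Negative.norm_Z_eq_sum _ _ _ hx, Negative.norm_Z_eq_sum _ _ _ hx]
  let lift : HexMidEdgeSAW Λ a z → HexMidEdgeSAW Λ' a z := fun γ =>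
    { verts := γ.verts
      subset := fun v hv => h (γ.subset v hv)
      nodup := γ.nodup
      isChain := γ.isChain
      head_mem := γ.head_mem
      getLast_mem := γ.getLast_mem
      eq_of_nil := γ.eq_of_nil
      edges_nodup := γ.edges_nodup
      fst_mem := by
        obtain ⟨he, v, hv, hvΛ⟩ := γ.fst_mem
        exact ⟨he, v, hv, h hvΛ⟩ }
  have hinj : Function.Injective lift := by
    intro γ γ' hγ
    have hv : (lift γ).verts = (lift γ').verts := by rw [hγ]
    exact HexMidEdgeSAW.ext hv
  calc ∑ γ : HexMidEdgeSAW Λ a z, hexCriticalFugacity ^ γ.length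
      = ∑ γ : HexMidEdgeSAW Λ a z, hexCriticalFugacity ^ (lift γ).length :=
        Finset.sum_congr rfl fun γ _ => rfl
    _ = ∑ γ' ∈ (Finset.univ : Finset (HexMidEdgeSAW Λ a z)).image lift,
          hexCriticalFugacity ^ γ'.length := by
        rw [Finset.sum_image fun γ _ γ' _ hγ => hinj hγ]
    _ ≤ ∑ γ' : HexMidEdgeSAW Λ' a z, hexCriticalFugacity ^ γ'.length :=
        Finset.sum_le_univ_sum_of_nonneg fun γ' => pow_nonneg hx _

/-- Monotonicity of finite sums over a finite set of mid-edges. -/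
theorem finsum_mem_mono {S : Set (Sym2 HexVertex)} (hS : S.Finite) {f g : Sym2 HexVertex → ℝ}
    (h : ∀ e ∈ S, f e ≤ g e) : ∑ᶠ e ∈ S, f e ≤ ∑ᶠ e ∈ S, g e := by
  rw [finsum_mem_eq_finite_toFinset_sum f hS, finsum_mem_eq_finite_toFinset_sum g hS]
  exact Finset.sum_le_sum fun e he => h e (hS.mem_toFinset.1 he)

/-! ### The canonical masses are positive (the boundary-row walk `a_R → c₀`) -/

theorem cMid_re : (hexMidpoint cEdge).re = 1 / 2 := by
  rw [cEdge, Negative.mid_re, Negative.pos_bv, Negative.pos_bv]; norm_num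

theorem cMid_im : (hexMidpoint cEdge).im = 0 := by
  rw [cEdge, Negative.mid_im, Negative.im_center_bv_even (r := 0) (p := 0) (by norm_num),
    Negative.im_center_bv_odd (r := -1) (p := 0) (by norm_num)]
  push_cast; ring

/-- Row-`0` vertices at positions `0 … 4R` lie in the canonical half-disc. -/
theorem bv_zero_mem_halfDisc {R : ℕ} (hR : 1 ≤ R) {p : ℤ} (hp0 : 0 ≤ p) (hp : p ≤ 4 * R) :
    Negative.bv 0 p ∈ halfDisc R := by
  rw [halfDisc, Finset.mem_filter, mem_ball, Negative.row_bv]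
  refine ⟨?_, le_rfl⟩
  rw [Complex.dist_eq]
  have hre : ((hexCenter (Negative.bv 0 p) - hexMidpoint cEdge).re : ℝ) = p / 2 := by
    rw [Complex.sub_re, Negative.re_center_bv, cMid_re]; ring
  have hlt := Negative.hgt_lt
  have hgt0 := Negative.hgt_pos
  have him : |(hexCenter (Negative.bv 0 p) - hexMidpoint cEdge).im| ≤ 1 := by
    rw [Complex.sub_im, cMid_im, sub_zero]
    rcases Int.emod_two_eq_zero_or_one (p - 0) with h | h
    · rw [Negative.im_center_bv_even h]
      have h0 : (0 : ℝ) ≤ Negative.hgt * (((0 : ℤ) : ℝ) + 1 / 3) := by push_cast; nlinarith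
      rw [abs_of_nonneg h0]
      push_cast; nlinarith
    · rw [Negative.im_center_bv_odd h]
      have h0 : (0 : ℝ) ≤ Negative.hgt * (((0 : ℤ) : ℝ) + 2 / 3) := by push_cast; nlinarith
      rw [abs_of_nonneg h0]
      push_cast; nlinarith
  have hpR : (p : ℝ) ≤ 4 * (R : ℝ) := by exact_mod_cast hp
  have hR1 : (1 : ℝ) ≤ R := by exact_mod_cast hR
  have hp0' : (0 : ℝ) ≤ p := by exact_mod_cast hp0
  have hp2 : (0 : ℝ) ≤ p / 2 := by positivity
  calc ‖hexCenter (Negative.bv 0 p) - hexMidpoint cEdge‖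
      ≤ |(hexCenter (Negative.bv 0 p) - hexMidpoint cEdge).re| +
          |(hexCenter (Negative.bv 0 p) - hexMidpoint cEdge).im| :=
        Complex.norm_le_abs_re_add_abs_im _
    _ ≤ p / 2 + 1 := by rw [hre, abs_of_nonneg hp2]; linarith
    _ < 4 * R := by linarith

/-- Row-`-1` vertices are not in the canonical half-disc. -/
theorem bv_neg_one_not_mem_halfDisc (R : ℕ) (p : ℤ) : Negative.bv (-1) p ∉ halfDisc R := by
  rw [halfDisc, Finset.mem_filter, Negative.row_bv]
  rintro ⟨-, h⟩
  omega

/-- The boundary-row chain of the canonical walk: `i ↦ (row 0, pos L - i)`. -/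
def rowZero (L : ℕ) (i : ℕ) : HexVertex := Negative.bv 0 ((L : ℤ) - (i : ℤ))

/-- **The canonical boundary-to-boundary mass is positive** (`R ≥ 1`): the walk along row `0` from
`a_R` to `c₀` (the landed `Negative.corridorWalk` + `pow_length_le_norm_Z`). -/
theorem canonical_pos {R : ℕ} (hR : 1 ≤ R) : 0 < Z (halfDisc R) (aEdge R) cEdge := by
  classical
  have hx : (0 : ℝ) ≤ hexCriticalFugacity := by unfold hexCriticalFugacity; positivity
  have hxpos : (0 : ℝ) < hexCriticalFugacity := by unfold hexCriticalFugacity; positivity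
  have hcΛ : ∀ i, i ≤ 4 * R → rowZero (4 * R) i ∈ halfDisc R := by
    intro i hi
    apply bv_zero_mem_halfDisc hR
    · push_cast; omega
    · push_cast; omega
  have hinj : ∀ i j, i ≤ 4 * R → j ≤ 4 * R → rowZero (4 * R) i = rowZero (4 * R) j → i = j := by
    intro i j _ _ h
    have := (Negative.bv_inj h).2
    omega
  have hadj : ∀ i, i < 4 * R → hexGraph.Adj (rowZero (4 * R) i) (rowZero (4 * R) (i + 1)) := by
    intro i _
    rw [rowZero, rowZero, Negative.adj_bv_iff]
    left
    refine ⟨rfl, Or.inr ?_⟩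
    push_cast; ring
  have huc : hexGraph.Adj (Negative.bv (-1) ((4 * R : ℕ) : ℤ)) (rowZero (4 * R) 0) := by
    rw [rowZero, Negative.adj_bv_iff]
    right; right
    refine ⟨by push_cast; ring, by norm_num, ?_⟩
    push_cast; omega
  have hu : Negative.bv (-1) ((4 * R : ℕ) : ℤ) ∉ halfDisc R := bv_neg_one_not_mem_halfDisc R _
  have hy : Negative.bv (-1) 0 ∉ halfDisc R := bv_neg_one_not_mem_halfDisc R _
  have haz : s(Negative.bv (-1) ((4 * R : ℕ) : ℤ), rowZero (4 * R) 0) ≠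
      s(rowZero (4 * R) (4 * R), Negative.bv (-1) 0) := by
    intro h
    have hmem : Negative.bv (-1) ((4 * R : ℕ) : ℤ) ∈
        s(rowZero (4 * R) (4 * R), Negative.bv (-1) 0) := by
      rw [← h]; exact Sym2.mem_mk_left _ _
    rcases Sym2.mem_iff.1 hmem with h1 | h1
    · have := (Negative.bv_inj h1).1; omega
    · have := (Negative.bv_inj h1).2; push_cast at this; omega
  let γ := Negative.corridorWalk (Λ := halfDisc R) (c := rowZero (4 * R)) (L := 4 * R)
    hcΛ hinj hadj huc hu hy haz
  have hle := Negative.pow_length_le_norm_Z (halfDisc R) _ _ γ hx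
  have hpow : (0 : ℝ) < hexCriticalFugacity ^ γ.length := pow_pos hxpos _
  have hZ : 0 < Z (halfDisc R) s(Negative.bv (-1) ((4 * R : ℕ) : ℤ), rowZero (4 * R) 0)
      s(rowZero (4 * R) (4 * R), Negative.bv (-1) 0) := lt_of_lt_of_le hpow hle
  have ha : s(Negative.bv (-1) ((4 * R : ℕ) : ℤ), rowZero (4 * R) 0) = aEdge R := by
    simp [rowZero, aEdge]
  have hc : s(rowZero (4 * R) (4 * R), Negative.bv (-1) 0) = cEdge := by
    simp [rowZero, cEdge]
  rw [ha, hc] at hZ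
  exact hZ

/-! ### Non-vacuity of the canonical family: `a_R`, `c₀` are door edges of `H_R`, and `c₀` is a
bulk mid-edge of the doubled half-disc -/

/-- The canonical root `a_R` is a boundary mid-edge of `H_R`. -/
theorem aEdge_mem_boundary {R : ℕ} (hR : 1 ≤ R) : aEdge R ∈ hexDomainBoundary (halfDisc R) := by
  have hadj : hexGraph.Adj (Negative.bv (-1) (4 * (R : ℤ))) (Negative.bv 0 (4 * (R : ℤ))) := by
    rw [Negative.adj_bv_iff]
    right; right
    exact ⟨rfl, by norm_num, by omega⟩
  refine ⟨(SimpleGraph.mem_edgeSet _).2 hadj, Negative.bv (-1) (4 * (R : ℤ)),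
    Negative.bv 0 (4 * (R : ℤ)), rfl, ?_, bv_neg_one_not_mem_halfDisc R _⟩
  exact bv_zero_mem_halfDisc hR (by positivity) le_rfl

/-- The canonical target `c₀` is a boundary mid-edge of `H_R`. -/
theorem cEdge_mem_boundary {R : ℕ} (hR : 1 ≤ R) : cEdge ∈ hexDomainBoundary (halfDisc R) := by
  have hadj : hexGraph.Adj (Negative.bv (-1) 0) (Negative.bv 0 0) := by
    rw [Negative.adj_bv_iff]
    right; right
    exact ⟨rfl, by norm_num, by norm_num⟩
  refine ⟨(SimpleGraph.mem_edgeSet _).2 hadj.symm, Negative.bv (-1) 0, Negative.bv 0 0,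
    Sym2.eq_swap, ?_, bv_neg_one_not_mem_halfDisc R _⟩
  exact bv_zero_mem_halfDisc hR le_rfl (by positivity)

/-- Both endpoints of `c₀` lie in the doubled half-disc: `c₀` is a bulk mid-edge of
`H_R ∪ Ball_R` (`R ≥ 1`). -/
theorem cEdge_subset_double {R : ℕ} (hR : 1 ≤ R) :
    ∀ v ∈ cEdge, v ∈ double (halfDisc R) cEdge R := by
  intro v hv
  rw [cEdge, Sym2.mem_iff] at hv
  rcases hv with rfl | rfl
  · exact subset_double _ _ _ (bv_zero_mem_halfDisc hR le_rfl (by positivity))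
  · rw [double, Finset.mem_union]
    right
    rw [mem_ball, Complex.dist_eq]
    have hre : (hexCenter (Negative.bv (-1) 0) - hexMidpoint cEdge).re = 0 := by
      rw [Complex.sub_re, Negative.re_center_bv, cMid_re]; norm_num
    have him : (hexCenter (Negative.bv (-1) 0) - hexMidpoint cEdge).im = -(Negative.hgt / 3) := by
      rw [Complex.sub_im, cMid_im, Negative.im_center_bv_odd (r := -1) (p := 0) (by norm_num)]
      push_cast; ring
    have hlt := Negative.hgt_lt
    have hgt0 := Negative.hgt_pos
    have hR1 : (1 : ℝ) ≤ R := by exact_mod_cast hR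
    calc ‖hexCenter (Negative.bv (-1) 0) - hexMidpoint cEdge‖
        ≤ |(hexCenter (Negative.bv (-1) 0) - hexMidpoint cEdge).re| +
            |(hexCenter (Negative.bv (-1) 0) - hexMidpoint cEdge).im| :=
          Complex.norm_le_abs_re_add_abs_im _
      _ = Negative.hgt / 3 := by
          rw [hre, him, abs_zero, zero_add, abs_neg,
            abs_of_nonneg (show (0 : ℝ) ≤ Negative.hgt / 3 by positivity)]
      _ < R := by linarith

/-! ### Composition 1: canonical restriction + ratio mixing ⟹ endpoint restriction -/

/-- `CanonicalRestriction t → RatioMixing → EndpointRestriction t` for every `t ≥ 0`: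
with `R = ⌊ρ'/δ⌋ ≥ 1` eventually, `c Z_{Λ⁺} Z_H ≤ Z_Λ Z_{H⁺}` and `c₀ R^{-t} Z_{H⁺} ≤ Z_H` give
`c c₀ R^{-t} Z_{Λ⁺} ≤ Z_Λ` (cancel `Z_{H⁺} > 0`, `canonical_pos` + `Z_mono`), and
`R^{-t} ≥ (ρ'/δ)^{-t} = ρ'^{-t} δ^{t}`. -/
theorem endpointRestriction_of_canonical {t : ℝ} (ht : 0 ≤ t) (hC : CanonicalRestriction t)
    (hM : RatioMixing) : EndpointRestriction t := by
  intro D ρ Λ m a b hF ρ' hρ' hρ'0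
  obtain ⟨c₀, hc₀, hcan⟩ := hC
  obtain ⟨c, hc, hmix⟩ := hM D ρ Λ m a b hF ρ' hρ' hρ'0
  refine ⟨c * c₀ * ρ' ^ (-t), by positivity, ?_⟩
  have hpos : ∀ᶠ δ : ℝ in nhdsWithin 0 (Set.Ioi 0), 0 < δ := eventually_mem_nhdsWithin
  have hsmall : ∀ᶠ δ : ℝ in nhdsWithin 0 (Set.Ioi 0), δ < ρ' :=
    Filter.mem_of_superset (Ioo_mem_nhdsGT hρ') fun δ hδ => hδ.2
  filter_upwards [hmix, hpos, hsmall] with δ hmixδ hδ hδρ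
  set R : ℕ := scaleR ρ' δ with hRdef
  have hR1 : 1 ≤ R := by
    show 1 ≤ ⌊ρ' / δ⌋₊
    apply Nat.le_floor
    rw [Nat.cast_one, le_div_iff₀ hδ]
    linarith
  have hRle : (R : ℝ) ≤ ρ' / δ := by
    show ((⌊ρ' / δ⌋₊ : ℕ) : ℝ) ≤ ρ' / δ
    exact Nat.floor_le (by positivity)
  have hRpos : (0 : ℝ) < R := Nat.cast_pos.2 (by omega)
  have hcanR := hcan R hR1
  have hZHp : 0 < Z (double (halfDisc R) cEdge R) (aEdge R) cEdge :=
    lt_of_lt_of_le (canonical_pos hR1) (Z_mono (subset_double _ _ _) _ _)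
  set ZΛ := Z (Λ δ) (a δ) (b δ)
  set ZΛp := Z (double (Λ δ) (b δ) (R : ℝ)) (a δ) (b δ)
  set ZH := Z (halfDisc R) (aEdge R) cEdge
  set ZHp := Z (double (halfDisc R) cEdge R) (aEdge R) cEdge
  have hZΛp : 0 ≤ ZΛp := Z_nonneg _ _ _
  -- the cancelled inequality
  have h1 : c * c₀ * (R : ℝ) ^ (-t) * ZΛp * ZHp ≤ ZΛ * ZHp :=
    calc c * c₀ * (R : ℝ) ^ (-t) * ZΛp * ZHp = (c * ZΛp) * (c₀ * (R : ℝ) ^ (-t) * ZHp) := by ring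
      _ ≤ (c * ZΛp) * ZH := mul_le_mul_of_nonneg_left hcanR (mul_nonneg hc.le hZΛp)
      _ = c * (ZΛp * ZH) := by ring
      _ ≤ ZΛ * ZHp := hmixδ
  have h2 : c * c₀ * (R : ℝ) ^ (-t) * ZΛp ≤ ZΛ := le_of_mul_le_mul_right h1 hZHp
  -- scale matching
  have hRt : (ρ' / δ) ^ (-t) ≤ (R : ℝ) ^ (-t) :=
    Real.rpow_le_rpow_of_nonpos hRpos hRle (by linarith)
  have hsplit : (ρ' / δ) ^ (-t) = ρ' ^ (-t) * δ ^ t := by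
    rw [Real.div_rpow hρ'.le hδ.le, Real.rpow_neg hδ.le, div_inv_eq_mul]
  calc c * c₀ * ρ' ^ (-t) * δ ^ t * ZΛp = c * c₀ * (ρ' / δ) ^ (-t) * ZΛp := by
        rw [hsplit]; ring
    _ ≤ c * c₀ * (R : ℝ) ^ (-t) * ZΛp := by
        apply mul_le_mul_of_nonneg_right _ hZΛp
        exact mul_le_mul_of_nonneg_left hRt (by positivity)
    _ ≤ ZΛ := h2

/-! ### Composition 2: interior Harnack + endpoint restriction ⟹ the crux at cut `s + t` -/

/-- The card's First lemma at a general cut: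
`δ²Σ_K Z_Λ ≤ δ²Σ_K Z_{Λ⁺} ≤ C δ^{-s} Z_{Λ⁺}(b_δ) ≤ (C/c) δ^{-s-t} Z_Λ(b_δ)` with `Λ⁺` the doubling at
the radius cap `ρ' = ρ₀`. -/
theorem massRatioAt_of (s t : ℝ) (hH : InteriorHarnack s) (hR : EndpointRestriction t) :
    MassRatioAt (s + t) := by
  intro D ρ Λ m a b hF K hK hKD
  have hρ0 : 0 < rho0 D ρ := rho0_pos D hF.1
  obtain ⟨C, hC⟩ := hH D ρ Λ m a b hF (rho0 D ρ) hρ0 le_rfl K hK hKD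
  obtain ⟨c, hc, hcR⟩ := hR D ρ Λ m a b hF (rho0 D ρ) hρ0 le_rfl
  refine ⟨max C 0 / c, ?_⟩
  have hpos : ∀ᶠ δ : ℝ in nhdsWithin 0 (Set.Ioi 0), 0 < δ := eventually_mem_nhdsWithin
  filter_upwards [hC, hcR, hpos] with δ hCδ hRδ hδ
  set Λp := double (Λ δ) (b δ) (scaleR (rho0 D ρ) δ) with hΛp
  -- the finite set of K-mid-edges of Λ_δ
  set S : Set (Sym2 HexVertex) :=
    {e : Sym2 HexVertex | e ∈ hexDomainMidEdges (Λ δ) ∧ (δ : ℂ) * hexMidpoint e ∈ K} with hSdef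
  have hSfin : S.Finite := (Negative.hexDomainMidEdges_finite (Λ δ)).subset fun e he => he.1
  -- step 1: monotonicity in the domain
  have h1 : ∑ᶠ e ∈ S, Z (Λ δ) (a δ) e ≤ ∑ᶠ e ∈ S, Z Λp (a δ) e :=
    finsum_mem_mono hSfin fun e _ => Z_mono (subset_double _ _ _) _ _
  have hZp0 : 0 ≤ Z Λp (a δ) (b δ) := Z_nonneg _ _ _
  have hrpow : (0 : ℝ) < δ ^ (-s) := Real.rpow_pos_of_pos hδ _
  have hrpow' : (0 : ℝ) < δ ^ t := Real.rpow_pos_of_pos hδ _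
  -- step 2: Harnack in the doubled domain, with a nonnegative constant
  have h2 : δ ^ 2 * ∑ᶠ e ∈ S, Z Λp (a δ) e ≤ max C 0 * δ ^ (-s) * Z Λp (a δ) (b δ) :=
    hCδ.trans (by gcongr; exact le_max_left _ _)
  -- step 3: the endpoint restriction bound, rewritten as an upper bound on Z_{Λ⁺}(b_δ)
  have h3 : Z Λp (a δ) (b δ) ≤ Z (Λ δ) (a δ) (b δ) / (c * δ ^ t) := by
    rw [le_div_iff₀ (mul_pos hc hrpow')]
    calc Z Λp (a δ) (b δ) * (c * δ ^ t) = c * δ ^ t * Z Λp (a δ) (b δ) := by ring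
      _ ≤ Z (Λ δ) (a δ) (b δ) := hRδ
  -- step 4: assemble; δ^{-s} / δ^{t} = δ^{-(s+t)}
  have hexp : δ ^ (-s) / δ ^ t = δ ^ (-(s + t)) := by
    rw [← Real.rpow_sub hδ]
    congr 1; ring
  calc δ ^ 2 * ∑ᶠ e ∈ S, Z (Λ δ) (a δ) e
      ≤ δ ^ 2 * ∑ᶠ e ∈ S, Z Λp (a δ) e := by gcongr
    _ ≤ max C 0 * δ ^ (-s) * Z Λp (a δ) (b δ) := h2
    _ ≤ max C 0 * δ ^ (-s) * (Z (Λ δ) (a δ) (b δ) / (c * δ ^ t)) :=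
        mul_le_mul_of_nonneg_left h3 (mul_nonneg (le_max_right _ _) hrpow.le)
    _ = max C 0 / c * (δ ^ (-s) / δ ^ t) * Z (Λ δ) (a δ) (b δ) := by
        field_simp
    _ = max C 0 / c * δ ^ (-(s + t)) * Z (Λ δ) (a δ) (b δ) := by rw [hexp]

/-! ## Composition: the line concludes the crux by name -/

/-- **The line concludes the crux.** `MassRatio` from the three stubs: ratio mixing transfers the
canonical restriction bound (stub 1, exponent `3/4`) to `EndpointRestriction (3/4)` in the frame,
and the interior Harnack at exponent `0` (stub 3) composes with it to the crux at the cut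
`0 + 3/4`. -/
theorem MassRatio_of : MassRatio := by
  have hER : EndpointRestriction (3 / 4) :=
    endpointRestriction_of_canonical (by norm_num) stub_canonicalRestriction stub_ratioMixing
  have h : MassRatioAt (0 + 3 / 4) := massRatioAt_of 0 (3 / 4) stub_interiorHarnack hER
  intro D ρ Λ m a b Zc hρ hflat hev hexh ha hb K hK hKD
  obtain ⟨C, hC⟩ := h D ρ Λ m a b ⟨hρ, hflat, hev, hexh, ha, hb⟩ K hK hKD
  refine ⟨C, hC.mono fun δ hδ => ?_⟩
  have hZc : ∀ e, ‖Zc δ e‖ = Z (Λ δ) (a δ) e := fun e => rfl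
  simp only [hZc]
  have e1 : (-(0 + 3 / 4) : ℝ) = -(3 : ℝ) / 4 := by norm_num
  rw [e1] at hδ
  exact hδ

/-! ## Reshape menu for the line lead (documentation only)

* Split the cut differently: `massRatioAt_of s t` and `endpointRestriction_of_canonical` are stated
  for every `s`, `t ≥ 0`; e.g. `stub_interiorHarnack : InteriorHarnack (1/16)` +
  `stub_canonicalRestriction : CanonicalRestriction (11/16)` composes by the same two lines
  (`MassRatioAt (1/16 + 11/16)`, then `norm_num` in `MassRatio_of`).
* The card's original two-factor form: replace stubs 1–2 by
  `theorem stub_endpointRestriction : EndpointRestriction (3 / 4) := by sorry` and feed it to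
  `massRatioAt_of 0 (3/4) stub_interiorHarnack` directly.
* Landing: `Theorems/` files cannot import `Cruxes/` workfiles — land `## Definitions` through
  `massRatioAt_of` (all sorry-free) as a `Theorems/MassRatio/…Defs.lean` first, then prove stubs
  against it (`propose --supports stmt-CriticalPhenomena-8550`), and re-run
  `ledger skeleton check` after any reshape so the registered stub signatures stay in sync.
* NOT available at the filed cut: the door decomposition / `BH` / `DoorSum(η₀)` soft variant
  (`IdeatorFiveSketch.door_decomposition`, card NOTE §5) proves only `EndpointRestriction (1 - η₀)`
  and needs the planner's re-cut of the pair (DefectDecoherence, MassRatio) to `c = 1 - η`.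
-/

end

end Summit.CriticalPhenomena.SAWScalingLimit.Cruxes.MassRatio.MirrorDoublingEndpointRestriction
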